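import Literature.Algebra.Polynomial.CasasAlvero.Degree5
import Literature.Algebra.Polynomial.CasasAlvero.CharThirteenSharp
import HarnessLib

/-!
# Casas-Alvero degrees in characteristic 13: the complete classification

`CharThirteenSharp.lean` reduced the classification of Casas-Alvero degrees in characteristic `13` to the single digit
`5`; `Degree5.lean` decides `CA_5` over every field (it holds unless the characteristic is one of the nine bad primes
`2, 3, 7, 11, 131, 193, 599, 3541, 8009`, and `13` is not among them).  Hence, over EVERY field `K` of characteristic `13`
(no perfectness needed: `CA_{5·13^k}` is obtained over the algebraic closure and descended),
`CA_d(K) ⟺ d = 0 ∨ d = a·13^k` with `1 ≤ a ≤ 5`.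
This is the third prime (after `11`, `CharElevenComplete.lean`, and the primes `2, 3, 5, 7` of
`SmallCharClassification.lean`) for which the set of Casas-Alvero degrees is completely determined in this directory, and the
first one in which a digit `≥ 5` survives.
-/

noncomputable section

open Polynomial

namespace Literature.Algebra.Polynomial.CasasAlvero

variable (K : Type*) [Field K] [CharP K 13]

/-- `CA_{5·13^k}` over every field of characteristic `13`. [cite: CastryckLaterveerOunaies2012, Thm. 4]
[cite: GrafVonBothmerEtAl2007, Prop. 6] -/
theorem holdsInDegree_five_mul_thirteen_pow (k : ℕ) : HoldsInDegree K (5 * 13 ^ k) := by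
  haveI : Fact (Nat.Prime 13) := ⟨by norm_num⟩
  exact holdsInDegree_five_mul_prime_pow_field K 13 (by norm_num) (by norm_num) (by norm_num) (by norm_num)
    (by norm_num) (by norm_num) (by norm_num) (by norm_num) (by norm_num) k

/-- **characteristic 13, complete**: over every field of characteristic `13`,
`CA_d ⟺ d = 0 ∨ d = a·13^k` with `1 ≤ a ≤ 5`. [cite: GrafVonBothmerEtAl2007, Props. 2, 6, 7]
[cite: CastryckLaterveerOunaies2012, Thm. 4] -/
theorem classification_char_thirteen_complete (d : ℕ) :
    HoldsInDegree K d ↔ d = 0 ∨ ∃ k a : ℕ, 0 < a ∧ a ≤ 5 ∧ d = a * 13 ^ k := by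
  constructor
  · intro h
    rcases (classification_char_thirteen_sharp K d).1 h with h0 | ⟨k, hk | hk | hk | hk | hk⟩
    · exact Or.inl h0
    · exact Or.inr ⟨k, 1, by norm_num, by norm_num, by simpa using hk⟩
    · exact Or.inr ⟨k, 2, by norm_num, by norm_num, hk⟩
    · exact Or.inr ⟨k, 3, by norm_num, by norm_num, hk⟩
    · exact Or.inr ⟨k, 4, by norm_num, by norm_num, hk⟩
    · exact Or.inr ⟨k, 5, by norm_num, by norm_num, hk⟩
  · rintro (h0 | ⟨k, a, ha0, ha5, rfl⟩)
    · exact (classification_char_thirteen_sharp K d).2 (Or.inl h0)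
    · interval_cases a
      · exact (classification_char_thirteen_sharp K _).2 (Or.inr ⟨k, Or.inl (by simp)⟩)
      · exact (classification_char_thirteen_sharp K _).2 (Or.inr ⟨k, Or.inr (Or.inl rfl)⟩)
      · exact (classification_char_thirteen_sharp K _).2 (Or.inr ⟨k, Or.inr (Or.inr (Or.inl rfl))⟩)
      · exact (classification_char_thirteen_sharp K _).2 (Or.inr ⟨k, Or.inr (Or.inr (Or.inr rfl))⟩)
      · exact holdsInDegree_five_mul_thirteen_pow K k

/-- The digit-`5` family is genuinely new in characteristic `13`: `5·13^k` is a Casas-Alvero degree that is not of the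
previously known shapes `p^k, 2p^k, 3p^k, 4p^k` — e.g. `CA_65` holds over every field of characteristic `13`. [folklore] -/
theorem holdsInDegree_sixtyFive_of_char_thirteen : HoldsInDegree K 65 := by
  simpa using holdsInDegree_five_mul_thirteen_pow K 1

end Literature.Algebra.Polynomial.CasasAlvero
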